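import Summits.HodgeConjecture.HodgeConjecture.Theorems.WeilTypeLadderQuadraticVariationalEngine
import Literature.AlgebraicGeometry.HodgeTheory.SemiregularVariationalHodgeTwisted
import HarnessLib

/-!
# WeilTypeLadder · the transport leaf at a semiregular anchor with a `B`-FIELD (Perry Thm 1.1 twisted; Markman's `κ`-class form)

b2b cell `hweil` (packet `run/shared/lean/b2b/hodge-weil/`, `b2b-hweil-pv2-g2/VARIATIONAL-G2.md` §3, §6 (3)). Prover 2,
generation 2 (variational). Sibling of `Theorems/WeilTypeLadderQuadraticVariationalEngine.lean` (p176392, the UNTWISTED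
engine in the ladder's binders). There the anchor object `E₀` must have `ch_k(E₀) = q_k·H^k` (`k ≠ n`),
`ch_n(E₀) = q_n·H^n + W` — in particular `c₁(E₀) = q₁·H|_{s₀}`. Markman's anchor sheaves `E = Φ(F₁ ⊠ F₂^∨)` on `X × X̂`
(arXiv:2502.03415) do NOT satisfy this: what is `Spin(V)_{η,B}`-invariant — hence flat and Hodge along the Weil family —
is `κ(E) := ch(E)·exp(-c₁(E)/rk E)` (§1.1), not `ch(E)`. Perry's Thm. 1.1 (2) WITH the `B`-field `B₀ = -c₁(E)/rk E`
(named claim-fact `Perry2026_semiregularTwisted_remainsAlgebraic`, `Literature/…/SemiregularVariationalHodgeTwisted.lean`,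
this seat) is the form that hosts such objects. This file proves the corresponding ENGINE in the binders of R∞var: for
every `n ≥ 1` and every `d`, Perry-twisted ∧ [anchor object `E₀` finite locally free, FULLY semiregular, with a rational
algebraic `B`-field `B₀` on `X_{s₀}` such that `(exp(B₀) ∪ ch(E₀))_k = q_k·H^k` (`k ≠ n`) and `= q_n·H^n + W|_{s₀}` (`k = n`)]
⟹ `W|_{X_s}` algebraic on EVERY fibre — so on this larger sub-class too the transport leaf R∞var is a theorem modulo
Perry, and the open content of R∞ is the anchor OBJECT with its `κ`-CLASS Hodge-flat and Weil-charged (any `c₁`).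
The proof is that of the route's `engine_of_perry` (crux 14642, lead c11) with the anchor equation twisted, followed by
the Lefschetz-(1,1)/Kleiman subtraction of the sibling. Nothing is asserted: the twisted Perry fact is a hypothesis;
Markman's REFLEXIVE sheaves are still outside the locally-free rendering (recorded gap). Sorry-free; no definition.
Serves stmt-HodgeConjecture-2522 without closing it.
-/

-- every declaration of this problem lives in `Summit.HodgeConjecture.HodgeConjecture.…` (summit = sub-problem)
set_option linter.dupNamespace false

noncomputable section

open CategoryTheory AlgebraicGeometry

namespace Summit.HodgeConjecture.HodgeConjecture.WeilTypeLadder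

open Literature.AlgebraicGeometry Literature.AlgebraicGeometry.Motives
open Literature.AlgebraicGeometry.HodgeTheory
open Literature.AlgebraicTopology.SingularHomology
open Summit.HodgeConjecture.HodgeConjecture.Theorems.HyperbolicEightfoldsSqrtMinus7.AnchorObject
  (complexBetti_map_cupPowTwo cupPowTwo_mem_algebraicClasses_abelian)

/-- **TWISTED ENGINE (Perry with `B`-field ⟹ the impure Weil section is algebraic on EVERY fibre).** Along a
smooth projective family `f : 𝒳 ⟶ S` of relative dimension `2n` over a smooth irreducible quasi-projective base, let
`H ∈ H²(𝒳)` have rational `(1,1)` restrictions and `W ∈ H^{2n}(𝒳)` rational `(n,n)` restrictions. If at ONE point `s₀`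
there are a finite locally free FULLY SEMIREGULAR `E₀` on the fibre and a rational algebraic class `B₀ ∈ H²(X_{s₀})` with
`(exp(B₀) ∪ ch(E₀))_k = q_k·H_{s₀}^k` (`k ≠ n`) and `(exp(B₀) ∪ ch(E₀))_n = q_n·H_{s₀}^n + W_{s₀}` in some Chern
character theory `C`, then `q_n·H_s^n + W_s` is ALGEBRAIC on `𝒳_s` for EVERY `s` — the route's `engine_of_perry` with
the anchor equation replaced by its `B`-twisted form. CONDITIONAL on `Perry2026_semiregularTwisted_remainsAlgebraic`.
[claim: Perry2026Semiregularity, status: under-review] [cite: Markman2025SecantWeil, §1.1 (the class κ) and §9] -/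
theorem engine_of_perry_twisted (hP : Perry2026_semiregularTwisted_remainsAlgebraic) (n : ℕ)
    {𝒳 S : SchemeOver ℂ} (f : 𝒳 ⟶ S) (hf : IsSmoothProjectiveFamily f (2 * n))
    (hirr : IrreducibleSpace S.left) (hS : AlgebraicGeometry.Smooth S.hom) (hSqp : IsQuasiProjectiveOver S)
    (H : complexBetti 𝒳 2)
    (hH : ∀ s, IsRationalClass (complexBetti.map (fiberι f s) 2 H) ∧
      IsOfHodgeType (2 * n) (fiberOver f s) 2 1 1 (complexBetti.map (fiberι f s) 2 H))
    (W : complexBetti 𝒳 (2 * n))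
    (hWrat : ∀ s, IsRationalClass (complexBetti.map (fiberι f s) (2 * n) W))
    (hWH : ∀ s, IsOfHodgeType (2 * n) (fiberOver f s) (2 * n) n n (complexBetti.map (fiberι f s) (2 * n) W))
    (s₀ : ComplexPoints S) (C : ChernCharacterBetti) (E₀ : (fiberOver f s₀).left.Modules)
    (hE₀ : IsFiniteLocallyFree E₀) (hsr : IsISemiregular hE₀ Set.univ)
    (B₀ : complexBetti (fiberOver f s₀) 2) (hB₀ : IsRationalClass B₀) (hB₀alg : B₀ ∈ algebraicClasses (fiberOver f s₀) 1)
    (q : ℕ → ℚ)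
    (hk : ∀ k : ℕ, k ≠ n →
      expTwistCh C (fiberOver f s₀) B₀ E₀ k = ((q k : ℚ) : ℂ) • cupPowTwo (complexBetti.map (fiberι f s₀) 2 H) k)
    (hn : expTwistCh C (fiberOver f s₀) B₀ E₀ n =
      ((q n : ℚ) : ℂ) • cupPowTwo (complexBetti.map (fiberι f s₀) 2 H) n +
        complexBetti.map (fiberι f s₀) (2 * n) W) :
    ∀ s : ComplexPoints S,
      ((q n : ℚ) : ℂ) • cupPowTwo (complexBetti.map (fiberι f s) 2 H) n +
          complexBetti.map (fiberι f s) (2 * n) W ∈ algebraicClasses (fiberOver f s) n := by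
  intro s
  haveI := hS
  haveI := hirr
  haveI : IsReduced S.left := isReduced_of_smooth_over_field S.hom
  have hint : IsIntegral S.left := isIntegral_of_irreducibleSpace_of_isReduced _
  -- the global classes `A k = q_k • H^k + [k = n] • W` on the total space
  let A : ∀ k : ℕ, complexBetti 𝒳 (2 * k) := fun k =>
    if h : k = n then ((q k : ℚ) : ℂ) • cupPowTwo H k + h ▸ W else ((q k : ℚ) : ℂ) • cupPowTwo H k
  have hAn : A n = ((q n : ℚ) : ℂ) • cupPowTwo H n + W := by
    show (if h : n = n then _ else _) = _
    rw [dif_pos rfl]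
  have hAk : ∀ k, k ≠ n → A k = ((q k : ℚ) : ℂ) • cupPowTwo H k := by
    intro k hk'
    show (if h : k = n then _ else _) = _
    rw [dif_neg hk']
  have hres : ∀ k s, complexBetti.map (fiberι f s) (2 * k) (((q k : ℚ) : ℂ) • cupPowTwo H k) =
      ((q k : ℚ) : ℂ) • cupPowTwo (complexBetti.map (fiberι f s) 2 H) k := by
    intro k s
    rw [map_smul, complexBetti_map_cupPowTwo]
  have hresn : ∀ s, complexBetti.map (fiberι f s) (2 * n) (A n) =
      ((q n : ℚ) : ℂ) • cupPowTwo (complexBetti.map (fiberι f s) 2 H) n +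
        complexBetti.map (fiberι f s) (2 * n) W := by
    intro s
    rw [hAn, map_add, hres n s]
  -- the family of sections (fibre restrictions of the `A k`)
  let w : ∀ (k : ℕ) (s : ComplexPoints S), complexBetti (fiberOver f s) (2 * k) :=
    fun k s => complexBetti.map (fiberι f s) (2 * k) (A k)
  have hwc : ∀ k, Continuous fun s => (⟨s, w k s⟩ : FiberClass f (2 * k)) := fun k =>
    continuous_globalSection f (2 * k) (A k)
  have hwH : ∀ k s, (⟨s, w k s⟩ : FiberClass f (2 * k)) ∈ locusOfHodgeClasses f (2 * n) k := by
    intro k s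
    rw [mem_locusOfHodgeClasses_iff]
    by_cases hkn : k = n
    · subst hkn
      show IsRationalClass (complexBetti.map (fiberι f s) (2 * k) (A k)) ∧
        IsOfHodgeType (2 * k) (fiberOver f s) (2 * k) k k (complexBetti.map (fiberι f s) (2 * k) (A k))
      rw [hresn s]
      refine ⟨?_, ?_⟩
      · exact (((hH s).1.cupPowTwo k).smul (q k)).add (hWrat s)
      · exact ((isOfHodgeType_cupPowTwo (hf.isSmoothProjective s) (hH s).2 k).smul _).add
          (hf.isSmoothProjective s) (hWH s)
    · show IsRationalClass (complexBetti.map (fiberι f s) (2 * k) (A k)) ∧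
        IsOfHodgeType (2 * n) (fiberOver f s) (2 * k) k k (complexBetti.map (fiberι f s) (2 * k) (A k))
      rw [hAk k hkn, hres k s]
      exact ⟨((hH s).1.cupPowTwo k).smul (q k),
        (isOfHodgeType_cupPowTwo (hf.isSmoothProjective s) (hH s).2 k).smul _⟩
  -- the values at `s₀` are the `B₀`-twisted Chern character of `E₀`
  have hw₀ : ∀ k, w k s₀ = expTwistCh C (fiberOver f s₀) B₀ E₀ k := by
    intro k
    by_cases hkn : k = n
    · subst hkn
      show complexBetti.map (fiberι f s₀) (2 * k) (A k) = _
      rw [hresn s₀, hn]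
    · show complexBetti.map (fiberι f s₀) (2 * k) (A k) = _
      rw [hAk k hkn, hres k s₀, hk k hkn]
  -- Perry, twisted
  have h := hP C f (2 * n) hf hSqp hint hS w hwc hwH s₀ E₀ hE₀ hsr B₀ hB₀ hB₀alg hw₀ s n
  have h' : w n s = ((q n : ℚ) : ℂ) • cupPowTwo (complexBetti.map (fiberι f s) 2 H) n +
      complexBetti.map (fiberι f s) (2 * n) W := hresn s
  rwa [h'] at h

/-- **R∞var's conclusion at a semiregular anchor WITH `B`-FIELD, every `n ≥ 1`, from the twisted Perry fact.** In the
binders of `WeilVariationalHodgeQuadratic` (abelian fibre charts `A'.X ≅ 𝒳_s` for every `s`), with `H`, `W` as in the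
untwisted sibling and an anchor object `(E₀, B₀)` as in `engine_of_perry_twisted`: `W|_{𝒳_s}` is algebraic for EVERY `s`
(the engine, then subtract `q_n·H_s^n`, algebraic by Lefschetz `(1,1)` + Kleiman on the abelian chart). On this
sub-class the transport leaf is DISCHARGED modulo the twisted Perry claim-fact; the open content of R∞ there is an anchor
object whose `κ`-class (twisted Chern character, any `c₁`) is Hodge-flat and Weil-charged — the shape of Markman's
secant sheaves (reflexive; locally free ones are what this rendering hosts).
[claim: Perry2026Semiregularity, status: under-review] [cite: Markman2025SecantWeil, §1.1 and Thm. 1.5.1] [cite: VoisinHodgeII2003, §9.2.4 Prop. 9.20] -/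
theorem weilVariationalHodgeQuadratic_conclusion_of_perryTwisted_semiregularAnchor
    (hP : Perry2026_semiregularTwisted_remainsAlgebraic) (n : ℕ) (hn : 1 ≤ n)
    {𝒳 S : Motives.SchemeOver ℂ} (f : 𝒳 ⟶ S) (hf : Motives.IsSmoothProjectiveFamily f (2 * n))
    (hirr : IrreducibleSpace S.left) (hS : AlgebraicGeometry.Smooth S.hom) (hSqp : IsQuasiProjectiveOver S)
    (H : complexBetti 𝒳 2)
    (hH : ∀ s, IsRationalClass (complexBetti.map (Motives.fiberι f s) 2 H) ∧
      IsOfHodgeType (2 * n) (Motives.fiberOver f s) 2 1 1 (complexBetti.map (Motives.fiberι f s) 2 H))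
    (W : complexBetti 𝒳 (2 * n))
    (hW : ∀ s, IsRationalClass (complexBetti.map (Motives.fiberι f s) (2 * n) W) ∧
      IsOfHodgeType (2 * n) (Motives.fiberOver f s) (2 * n) n n (complexBetti.map (Motives.fiberι f s) (2 * n) W))
    (hchart : ∀ s, ∃ A' : Motives.AbelianVariety ℂ, A'.dim = 2 * n ∧ Nonempty (A'.X ≅ Motives.fiberOver f s))
    (s₀ : Motives.ComplexPoints S) (C : ChernCharacterBetti) (E₀ : (Motives.fiberOver f s₀).left.Modules)
    (hE₀ : Motives.IsFiniteLocallyFree E₀) (hsr : IsISemiregular hE₀ Set.univ)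
    (B₀ : complexBetti (Motives.fiberOver f s₀) 2) (hB₀ : IsRationalClass B₀)
    (hB₀alg : B₀ ∈ algebraicClasses (Motives.fiberOver f s₀) 1) (q : ℕ → ℚ)
    (hk : ∀ k : ℕ, k ≠ n →
      expTwistCh C (Motives.fiberOver f s₀) B₀ E₀ k =
        ((q k : ℚ) : ℂ) • cupPowTwo (complexBetti.map (Motives.fiberι f s₀) 2 H) k)
    (hchn : expTwistCh C (Motives.fiberOver f s₀) B₀ E₀ n =
      ((q n : ℚ) : ℂ) • cupPowTwo (complexBetti.map (Motives.fiberι f s₀) 2 H) n +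
        complexBetti.map (Motives.fiberι f s₀) (2 * n) W) :
    ∀ s : Motives.ComplexPoints S,
      complexBetti.map (Motives.fiberι f s) (2 * n) W ∈ algebraicClasses (Motives.fiberOver f s) n := by
  intro s
  obtain ⟨m, rfl⟩ : ∃ m, n = m + 1 := ⟨n - 1, by omega⟩
  have halg := engine_of_perry_twisted hP (m + 1) f hf hirr hS hSqp H hH W (fun s ↦ (hW s).1) (fun s ↦ (hW s).2)
    s₀ C E₀ hE₀ hsr B₀ hB₀ hB₀alg q hk hchn s
  obtain ⟨A', hA'dim, ⟨e₁⟩⟩ := hchart s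
  have hA'sp : Motives.IsSmoothProjective (2 * (m + 1)) A'.X := by
    have h := Motives.AbelianVariety.isSmoothProjective_holds (A := A')
    rw [Motives.AbelianVariety.isSmoothProjective, hA'dim] at h
    exact h
  have hh₁alg : complexBetti.map e₁.hom 2 (complexBetti.map (Motives.fiberι f s) 2 H) ∈ algebraicClasses A'.X 1 :=
    lefschetzOneOne_rational_holds hA'sp _ ((hH s).1.map _) ((hH s).2.map_of_iso e₁)
  have hh₁n : complexBetti.map e₁.hom (2 * (m + 1))
      (cupPowTwo (complexBetti.map (Motives.fiberι f s) 2 H) (m + 1)) ∈ algebraicClasses A'.X (m + 1) := by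
    rw [complexBetti_map_cupPowTwo]
    exact cupPowTwo_mem_algebraicClasses_abelian A' hh₁alg m
  have hHn : cupPowTwo (complexBetti.map (Motives.fiberι f s) 2 H) (m + 1) ∈
      algebraicClasses (Motives.fiberOver f s) (m + 1) :=
    Theorems.HeckePrymWeilLine.owf_isoTransport _ A' e₁ (m + 1) _ hh₁n
  have h := Submodule.sub_mem _ halg (Submodule.smul_mem _ (((q (m + 1) : ℚ) : ℂ)) hHn)
  rwa [add_sub_cancel_left] at h

/-- **The `B`-field on an abelian anchor costs nothing**: on the anchor fibre of a family whose fibres are abelian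
varieties, every RATIONAL `(1,1)` class `B₀` is algebraic (Lefschetz `(1,1)`, discharged in the tree), so the
algebraicity hypothesis `hB₀alg` of the twisted engine is met by `B₀ = -c₁(E₀)/rk` as soon as it is of type `(1,1)`
(automatic for a Chern class of an algebraic bundle). [cite: VoisinHodgeI2002, Thm. 11.30] -/
theorem bField_mem_algebraicClasses_of_abelianChart {𝒳 S : Motives.SchemeOver ℂ} (f : 𝒳 ⟶ S) {n : ℕ}
    (s₀ : Motives.ComplexPoints S) (A' : Motives.AbelianVariety ℂ) (hA' : A'.dim = n)
    (e₀ : A'.X ≅ Motives.fiberOver f s₀) (B₀ : complexBetti (Motives.fiberOver f s₀) 2) (hB₀ : IsRationalClass B₀)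
    (hB₀H : IsOfHodgeType n (Motives.fiberOver f s₀) 2 1 1 B₀) :
    B₀ ∈ algebraicClasses (Motives.fiberOver f s₀) 1 := by
  have hA'sp : Motives.IsSmoothProjective n A'.X := by
    have h := Motives.AbelianVariety.isSmoothProjective_holds (A := A')
    rw [Motives.AbelianVariety.isSmoothProjective, hA'] at h
    exact h
  have h₁ : complexBetti.map e₀.hom 2 B₀ ∈ algebraicClasses A'.X 1 :=
    lefschetzOneOne_rational_holds hA'sp _ (hB₀.map _) (hB₀H.map_of_iso e₀)
  exact Theorems.HeckePrymWeilLine.owf_isoTransport _ A' e₀ 1 _ h₁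

end Summit.HodgeConjecture.HodgeConjecture.WeilTypeLadder

end
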